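import Mathlib
import HarnessLib
import Summits.QuantumFields.YangMills.Theses.GuardedThresholdRemoval
import Literature.MathematicalPhysics.QuantumFieldTheory.Balaban1983to89.BlockAveragingExpMeanLogContinuous

/-!
# GuardedThresholdRemoval — `CoarseObsContinuousOffGuard` (LINE g7-C of ideator seat ym-idea-1; support item)

Route `route-QuantumFields-GuardedThresholdRemoval` (closes rung R3 `T3YM3TorusStatement.YM3TorusSU2` BY NAME; no summit is proved by this
line) split its transfer crux `GuardedTransfer` (stmt-QuantumFields-28026) into `ThinLevyCauchy` (proved in
`Theorems/GuardedThresholdRemovalThinLevyCauchy`) and THIS support statement: the coarse observable `Φ_{Cs}` of the once-refined family, read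
through Bałaban's PRINTED block averaging `expMeanLogSU` (tree `T3ThresholdRemoval.coarseObs F 1 ℰp Cs`), is continuous at every configuration
of the refined unit lattice none of whose (0.4)-loop variables lies ON a guard sphere `dist₁(W_{c,i}) = δ`.
Proof (§1, any `SU(N)`, any lattice `P`, any level `j`): the guard `∀ i, dist₁(W_{c,i}) < δ` and its strict complement are OPEN, so off the
spheres the guarded correction factor `corr` of (0.4) is LOCALLY either the printed `exp[mean log]` — continuous strictly inside the guard,
where the series logarithm is analytic (tree `MatrixLog.analyticAt_mlog`, `ExpMeanLog.eml_eq_exp_meanLog`) — or the constant `1`; the axial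
factor is continuous everywhere (tree `BlockAveraging.continuous_axialAvg`).  §2 transports this to the statement's shape: one (0.4)-step on
the refined unit lattice `(F.refine 1).P 0` IS the once-iterated averaging of `F.P 1` read through `fieldShift` (tree
`T3LevelShift.avgFun_fieldShift`), and `Re tr` of a holonomy is continuous (tree `BlockAveraging.continuous_holAt`).
-/

open Filter Topology NormedSpace
open Literature.MathematicalPhysics.QuantumFieldTheory.Balaban1983to89
open Literature.MathematicalPhysics.QuantumFieldTheory.Balaban1983to89.T3ContinuumYM3Torus
open Literature.MathematicalPhysics.QuantumFieldTheory.Balaban1983to89.T3LevelShift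
open Literature.MathematicalPhysics.QuantumFieldTheory.Balaban1983to89.T3ThresholdRemoval
open Literature.MathematicalPhysics.QuantumFieldTheory.Balaban1983to89.T3UnitLawDensityEML (ℰp measurableE_ℰp)
open BlockAveraging ExpMeanLog AveragingRT

namespace Summit.QuantumFields.YangMills.Theses.GuardedThresholdRemoval

/-! ## §1 The printed block averaging is continuous off the guard spheres (any `SU(N)`, any lattice, any level) -/

section OffGuard

open scoped Matrix.Norms.L2Operator

variable {P : Params} {j : ℕ} {n : Type} [Fintype n] [DecidableEq n] [Nonempty n]

omit [Nonempty n] in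
/-- The mean logarithm is continuous at every family of matrices with all `‖W_i − 1‖ < 1` (the series logarithm is analytic there; the
tree's lemma of the same name is private). [folklore] -/
theorem continuousAt_meanLog_of_lt_one {ι : Type*} [Fintype ι] {W : ι → Matrix n n ℂ} (hW : ∀ i, ‖W i - 1‖ < 1) :
    ContinuousAt (meanLog : (ι → Matrix n n ℂ) → Matrix n n ℂ) W := by
  have hsum : ContinuousAt (fun W : ι → Matrix n n ℂ => ∑ i, MatrixLog.mlog (W i)) W :=
    tendsto_finsetSum _ fun i _ =>
      ContinuousAt.comp (f := fun W : ι → Matrix n n ℂ => W i) (AnalyticAt.continuousAt (MatrixLog.analyticAt_mlog (hW i)))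
        (continuous_apply (A := fun _ : ι => Matrix n n ℂ) i).continuousAt
  unfold meanLog
  exact (continuousAt_const (y := ((Fintype.card ι : ℂ))⁻¹)).smul hsum

/-- STRICTLY INSIDE THE GUARD the printed operation `ESU` (= `exp[mean log]` there, `1` outside) is continuous, as a matrix-valued map of
the family: the guard is open and `exp ∘ meanLog` is continuous on it. [cite: Balaban1987RG1, (0.4) p.253] -/
theorem continuousAt_coe_ESU {ι : Type*} [Fintype ι] {W : ι → Matrix.specialUnitaryGroup n ℂ}
    (hW : ∀ i, ‖(W i : Matrix n n ℂ) - 1‖ < deltaSU n) :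
    ContinuousAt (fun W' : ι → Matrix.specialUnitaryGroup n ℂ =>
      ((ESU W' : Matrix.specialUnitaryGroup n ℂ) : Matrix n n ℂ)) W := by
  letI : NormedAlgebra ℚ (Matrix n n ℂ) := NormedAlgebra.restrictScalars ℚ ℂ _
  have hcoe : Continuous fun W' : ι → Matrix.specialUnitaryGroup n ℂ => fun i => (W' i : Matrix n n ℂ) :=
    continuous_pi fun i => continuous_subtype_val.comp (continuous_apply i)
  have hopen : IsOpen {W' : ι → Matrix.specialUnitaryGroup n ℂ | ∀ i, ‖(W' i : Matrix n n ℂ) - 1‖ < deltaSU n} := by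
    rw [Set.setOf_forall]
    exact isOpen_iInter_of_finite fun i =>
      isOpen_lt ((continuous_subtype_val.comp (continuous_apply i)).sub continuous_const).norm continuous_const
  have hev : (fun W' : ι → Matrix.specialUnitaryGroup n ℂ => ((ESU W' : Matrix.specialUnitaryGroup n ℂ) : Matrix n n ℂ)) =ᶠ[𝓝 W]
      fun W' => exp (meanLog fun i => (W' i : Matrix n n ℂ)) :=
    Filter.eventually_of_mem (hopen.mem_nhds hW) fun W' hW' => by
      simp only [Set.mem_setOf_eq] at hW'
      show ((ESU W' : Matrix.specialUnitaryGroup n ℂ) : Matrix n n ℂ) = exp (meanLog fun i => (W' i : Matrix n n ℂ))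
      rw [coe_ESU_of_small hW', eml_eq_exp_meanLog]
  refine (continuousAt_congr hev).2 ?_
  have h1 : ∀ i, ‖(W i : Matrix n n ℂ) - 1‖ < 1 := fun i => (lt_third_of_lt_deltaSU (hW i)).trans (by norm_num)
  exact exp_continuous.continuousAt.comp
    (ContinuousAt.comp (f := fun W' : ι → Matrix.specialUnitaryGroup n ℂ => fun i => (W' i : Matrix n n ℂ))
      (continuousAt_meanLog_of_lt_one h1) hcoe.continuousAt)

/-- **THE GUARDED CORRECTION FACTOR OF (0.4) AT THE PRINTED AVERAGING IS CONTINUOUS OFF THE GUARD SPHERES**: at a configuration none of whose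
loop variables at `c` lies on `dist₁ = δ`, `U ↦ corr(U, c)` is continuous — locally it is either `E(W_{c,·})` with the family strictly
inside the guard, or the constant `1`. [cite: Balaban1987RG1, (0.4) p.253] -/
theorem continuousAt_corr_expMeanLogSU {U : GaugeField P j (Matrix.specialUnitaryGroup n ℂ)} (c : PBond P (j+1))
    (hU : ∀ i, dist1 (loopHol U c i) ≠ (expMeanLogSU (n := n)).δ) :
    ContinuousAt (fun V : GaugeField P j (Matrix.specialUnitaryGroup n ℂ) => corr (expMeanLogSU (n := n)) V c) U := by
  classical
  -- `dist₁` is continuous on `SU(N)` (tree `UnitaryModel.continuous_opDist1`; cf. `SubstrateBackground.continuous_reTr_specialUnitaryGroup`)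
  have hd : Continuous (dist1 : Matrix.specialUnitaryGroup n ℂ → ℝ) :=
    UnitaryModel.continuous_opDist1.comp (Literature.MathematicalPhysics.QuantumLattice.continuous_fundamentalRep n)
  have hWc : ∀ i, Continuous fun V : GaugeField P j (Matrix.specialUnitaryGroup n ℂ) => dist1 (loopHol V c i) := fun i =>
    hd.comp ((continuous_apply i).comp (continuous_loopHol c))
  by_cases hs : BlockAveraging.Small (expMeanLogSU (n := n)) U c
  · -- inside the guard: an open condition, on which `corr = E(loop variables)`
    have hopen : IsOpen {V : GaugeField P j (Matrix.specialUnitaryGroup n ℂ) | BlockAveraging.Small (expMeanLogSU (n := n)) V c} := by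
      have hset : {V : GaugeField P j (Matrix.specialUnitaryGroup n ℂ) | BlockAveraging.Small (expMeanLogSU (n := n)) V c} =
          ⋂ i : Idx P, {V | dist1 (loopHol V c i) < (expMeanLogSU (n := n)).δ} := by
        ext V
        simp only [BlockAveraging.Small, Set.mem_setOf_eq, Set.mem_iInter]
      rw [hset]
      exact isOpen_iInter_of_finite fun i => isOpen_lt (hWc i) continuous_const
    have hev : (fun V : GaugeField P j (Matrix.specialUnitaryGroup n ℂ) => corr (expMeanLogSU (n := n)) V c) =ᶠ[𝓝 U]
        fun V => (expMeanLogSU (n := n)).avg (loopHol V c) :=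
      Filter.eventually_of_mem (hopen.mem_nhds hs) fun V hV => by
        simp only [Set.mem_setOf_eq] at hV
        simp only [corr, if_pos hV]
    refine (continuousAt_congr hev).2 ?_
    have hfam : Continuous fun V : GaugeField P j (Matrix.specialUnitaryGroup n ℂ) =>
        (loopHol V c) ∘ (LoopAverage.enum (Idx P)).symm :=
      continuous_pi fun k => (continuous_apply _).comp (continuous_loopHol c)
    have hW : ∀ k, ‖((((loopHol U c) ∘ (LoopAverage.enum (Idx P)).symm) k : Matrix.specialUnitaryGroup n ℂ) : Matrix n n ℂ) - 1‖
        < deltaSU n := fun k => hs _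
    have h : ContinuousAt (fun V : GaugeField P j (Matrix.specialUnitaryGroup n ℂ) =>
        ((ESU ((loopHol V c) ∘ (LoopAverage.enum (Idx P)).symm) : Matrix.specialUnitaryGroup n ℂ) : Matrix n n ℂ)) U :=
      ContinuousAt.comp (f := fun V : GaugeField P j (Matrix.specialUnitaryGroup n ℂ) =>
        (loopHol V c) ∘ (LoopAverage.enum (Idx P)).symm) (continuousAt_coe_ESU hW) hfam.continuousAt
    rw [Topology.IsInducing.subtypeVal.continuousAt_iff]
    exact h
  · -- outside the closed guard (off the spheres): an open condition, on which `corr = 1`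
    obtain ⟨i, hi⟩ := not_forall.mp hs
    have hi' : (expMeanLogSU (n := n)).δ < dist1 (loopHol U c i) := lt_of_le_of_ne (not_lt.mp hi) (hU i).symm
    have hopen : IsOpen {V : GaugeField P j (Matrix.specialUnitaryGroup n ℂ) | (expMeanLogSU (n := n)).δ < dist1 (loopHol V c i)} :=
      isOpen_lt continuous_const (hWc i)
    have hev : (fun V : GaugeField P j (Matrix.specialUnitaryGroup n ℂ) => corr (expMeanLogSU (n := n)) V c) =ᶠ[𝓝 U] fun _ => 1 :=
      Filter.eventually_of_mem (hopen.mem_nhds hi') fun V hV => by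
        simp only [Set.mem_setOf_eq] at hV
        have hns : ¬ BlockAveraging.Small (expMeanLogSU (n := n)) V c := fun h => (lt_asymm (h i)) hV
        simp only [corr, if_neg hns]
    exact (continuousAt_congr hev).2 continuousAt_const

/-- **ONE STEP OF THE PRINTED BLOCK AVERAGING (0.4) IS CONTINUOUS OFF THE GUARD SPHERES** (as a map to the coarse configuration space).
[cite: Balaban1987RG1, (0.4) p.253] -/
theorem continuousAt_avgFun_expMeanLogSU {U : GaugeField P j (Matrix.specialUnitaryGroup n ℂ)}
    (hU : ∀ (c : PBond P (j+1)) (i : Idx P), dist1 (loopHol U c i) ≠ (expMeanLogSU (n := n)).δ) :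
    ContinuousAt (avgFun (expMeanLogSU (n := n)) :
      GaugeField P j (Matrix.specialUnitaryGroup n ℂ) → GaugeField P (j+1) (Matrix.specialUnitaryGroup n ℂ)) U := by
  refine continuousAt_pi.2 fun c => ?_
  show ContinuousAt (fun V : GaugeField P j (Matrix.specialUnitaryGroup n ℂ) => corr (expMeanLogSU (n := n)) V c * axialAvg V c) U
  exact (continuousAt_corr_expMeanLogSU c (hU c)).mul ((continuous_apply c).comp continuous_axialAvg).continuousAt

end OffGuard

/-! ## §2 The statement -/

/-- `fieldShift` is continuous (a reindexing of coordinates; the tree's lemma is private). [folklore] -/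
theorem continuous_fieldShift' (F : T3Family) {m K j m' K' j' : ℕ} {G : Type*} [TopologicalSpace G]
    (h : (F.PP m K).sitesPerDir j = (F.PP m' K').sitesPerDir j') :
    Continuous (fieldShift h : GaugeField (F.PP m' K') j' G → GaugeField (F.PP m K) j G) :=
  continuous_pi fun _ => continuous_apply _

/-- **`CoarseObsContinuousOffGuard` HOLDS**: the coarse observable of the once-refined family at the printed averaging is continuous at every
configuration of the refined unit lattice off the guard spheres. [cite: Balaban1987RG1, (0.4)/(0.11) p.253] -/
theorem coarseObsContinuousOffGuard_holds : CoarseObsContinuousOffGuard := by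
  intro F Cs U hU
  have hre : Continuous (reTr : Matrix.specialUnitaryGroup (Fin 2) ℂ → ℝ) :=
    UnitaryModel.continuous_nReTr.comp (Literature.MathematicalPhysics.QuantumLattice.continuous_fundamentalRep (Fin 2))
  have h₁ : (F.PP F.m 1).sitesPerDir (0 + 1) = (F.PP (F.m + 1) 0).sitesPerDir (0 + 1) := F.sitesPerDir_eq (by omega)
  have havg : ContinuousAt (avgFun ℰp :
      GaugeField ((F.refine 1).P 0) 0 (Matrix.specialUnitaryGroup (Fin 2) ℂ) →
        GaugeField ((F.refine 1).P 0) 1 (Matrix.specialUnitaryGroup (Fin 2) ℂ)) U :=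
    continuousAt_avgFun_expMeanLogSU hU
  have key : ∀ C : ULoop3 F, ContinuousAt (fun u : GaugeField ((F.refine 1).P 0) 0 (Matrix.specialUnitaryGroup (Fin 2) ℂ) =>
      F.avgObs ℰp 1 C (fieldShift (sitesPerDir_refine_unit F 1) u)) U := by
    intro C
    have hfun : (fun u : GaugeField ((F.refine 1).P 0) 0 (Matrix.specialUnitaryGroup (Fin 2) ℂ) =>
        F.avgObs ℰp 1 C (fieldShift (sitesPerDir_refine_unit F 1) u)) =
        fun u => T4Continuum.loopAt (fieldShift h₁ (avgFun ℰp u)) (C.1.atLevel 1) := by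
      funext u
      show T4Continuum.loopAt (avgFun ℰp (fieldShift (sitesPerDir_refine_unit F 1) u)) (C.1.atLevel 1) = _
      rw [avgFun_fieldShift ℰp (sitesPerDir_refine_unit F 1) h₁]
    rw [hfun]
    unfold T4Continuum.loopAt
    exact (hre.comp (continuous_holAt (C.1.atLevel 1))).continuousAt.comp
      ((continuous_fieldShift' F h₁).continuousAt.comp havg)
  show Tendsto (fun u => (Cs.map fun C => F.avgObs ℰp 1 C (fieldShift (sitesPerDir_refine_unit F 1) u)).prod) (𝓝 U)
    (𝓝 ((Cs.map fun C => F.avgObs ℰp 1 C (fieldShift (sitesPerDir_refine_unit F 1) U)).prod))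
  exact tendsto_list_prod Cs fun C _ => key C

end Summit.QuantumFields.YangMills.Theses.GuardedThresholdRemoval
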